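/-
Copyright (c) 2026 the pub-hodgecm-mathlib formalisation cell (harness21).  Prover seat hodgecm-mathlib-K2E4-p10 (g11), Track B «K2-LIT»,
#184♮ = hLiu418 = `stmt-HodgeConjecture-24832`; socket #41, KIND 1 — (K1a-T)(L2-dock)(ρ) ED.2 AT THE WEYL FRAME (K1a desk K2Liu-p01 (g11) WORD #29 (1) NEXT
«the `hFrx` letter», 2026-09-05T03:41:04Z; this seat's finding 03:42:46Z): the record's frame of the Weyl element is `u_w·J` with the Siegel-Levi sign unit
`u_w = diag(i·sgn t) ⊕ diag(i·sgn t)` — never `J` — so the arch local reading of record is re-keyed with ONE merged letter «the flat section READ AT THE WEYL FRAME is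
scalar type», and the payer split isolates the pure scalar-type reading (K2Liu-p23's (T-σ) census, WORD #27).
THEOREMS ONLY (no `def`, no `instance`, no notation, no named-fact hypothesis, no `sorry`).
-/
import Summits.HodgeConjecture.HodgeConjecture.Theorems.K2LiuKindOneSingularArchLocalReadingOfRecord   -- ★ p865158 (this seat): §1 framed corner index, §3 `hsc∕hscb_of_record`
import Summits.HodgeConjecture.HodgeConjecture.Theorems.K2LiuArchInducedTubeSection                  -- ★ `isArchSiegelSection_archScalarSection` (parabolic law of `f⁰_{s,k}`)
import Summits.HodgeConjecture.HodgeConjecture.Theorems.K2LiuHermitianTubeFrameWeyl                  -- ★ `frame_mul_blockDiag_mul_frameInv` (`T·diag(1,−1)·T⁻¹` in letters)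
import HarnessLib

/-!
# Crux `HLiu418`, socket #41, KIND 1 a♮ — (K1a-T)(L2-dock)(ρ) ED.2 `K2LiuKindOneSingularArchLocalReadingAtWeylFrame`: THE LOCAL READING OF RECORD AT THE WEYL FRAME `u_w·J`

Cell `hodgecm-mathlib`, crux item hLiu418 = `stmt-HodgeConjecture-24832` (helper lane `--supports … --as helper`, count-neutral), route of record `HCCMUnconditional`;
squad K2 ∕ K2Liu, road `K2_Liu`, socket #41, KIND 1, block K1-a♮.  CONSUMER: the K1-a♮ ∕ D-1 tie (typ4 v30∕v31): `have hA₀ := hA₀_of_hA₀'₂ … (hFsx_of_scalarType … hFrx hFs) …`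
⇒ ★ p864726 `blockD_arch_of_record`'s `hA₀` from (α) ED.3 ★ p865128's (C2p)(C2n).

THE FINDING (K2 bus 2026-09-05T03:42:46Z).  In ★ p864726's local integrand the left frame is `Frx X w = Fr((w_Δ)_∞) w`, and ★ `K2LiuHolTubeRigidityOfFrame.frame_archPart_weylDelta`
reads it as `T_w·diag(1,−1)·T_w⁻¹`; at the explicit Shimura frames (`D = diag √(|t|∕2)`, `C = diag(i·sgn t·√(|t|∕2))`) this is `(0 −diag(i·sgn t); diag(i·sgn t) 0) = u_w·J`
(§1 `shimuraFrame_weyl_eq`, `leviSign_mul_J`) with the SIEGEL-LEVI unit `u_w = diag(i·sgn t) ⊕ diag(i·sgn t) ∈ U(J) ∩ P_Δ` (§1 `leviSign_mem_UJ`) — NOT `J` (★ p865158's by-value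
`hFrx : Frx = J` is unpayable at the record).  Since `f⁰_{s,k}` obeys the parabolic law (★ `isArchSiegelSection_archScalarSection`) and `det (u_w)₁₁ = −sgn t₀·sgn t₁ = ±1`,
`f⁰_{s,k}(u_w·m) = (−sgn t₀·sgn t₁)^k · f⁰_{s,k}(m)` — a CONSTANT (§1 `archScalarSection_leviSign_mul`).  Hence the cure: §2 re-keys ★ p865158's `theta_eq_of_record ∕ hA₀_of_hA₀'`
with ONE merged by-value letter `hFsx : Fs X p w s (Frx X w · m) = cF p w · archScalarSection (k p w) s (J·m)` on `U(J)` («the flat section read at the Weyl frame is scalar type»)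
in place of `(hFs, hFrx)` — same conclusions, same `hsc`-lambda (so ★ p865158 §3 `hsc∕hscb_of_record` still pay ED.3's `hsc hscb`); and §3 `hFsx_of_scalarType` PAYS `hFsx` from the
record's `hFrx : Frx X w = T_w·diag(1,−1)·T_w⁻¹` (★ `frame_archPart_weylDelta` by name) and the PURE scalar-type reading `hFs : Fs X p w s m = cF p w · f⁰_{s,k p w}(m)` on `U(J)`
(K2Liu-p23's (T-σ) letter — the only residual) at `cF' p w := cF p w · (−sgn t₀ sgn t₁)^{k p w}`.
* §1 `shimuraFrame_weyl_eq`, `leviSign_mul_J`, `leviSign_mem_UJ`, **`archScalarSection_leviSign_mul`**;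
* §2 **`theta_eq_of_record₂`**, **`hA₀_of_hA₀'₂`** (★ p864726 `hA₀` :121–:128 from ★ p865128 (C2p)(C2n), merged letter `hFsx`);
* §3 **`hFsx_of_scalarType`** (the payer split).
HONEST LABEL.  Count-neutral helper (frame algebra + the parabolic law of the scalar-type vector); it closes no socket: `HC_CM` is proved only modulo the 7 printed citations
(2 remaining named inputs: hLiu418 = `stmt-HodgeConjecture-24832`, h413 = `stmt-HodgeConjecture-24833`) until rung 0 closes.

## References
* [Shimura1997] G. Shimura, *Euler Products and Eisenstein Series*, CBMS 93 (1997): §6.4 (the Cayley∕tube frames), §16.4 (`f⁰_{s,k}`, parabolic law), §18.4.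
* [GelbartPiatetskishapiroRallis1987] S. Gelbart, I. Piatetski-Shapiro, S. Rallis, *Explicit Constructions of Automorphic L-Functions*, LNM 1254 (1987): Part A §1 (`w_Δ`).
* [KudlaRallis1994] S. Kudla, S. Rallis, *A regularized Siegel–Weil formula: the first term identity*, Ann. of Math. 140 (1994): §2 (2.10)–(2.12).
-/

set_option autoImplicit false
-- the mandated namespace repeats the single-problem summit's segment (`HodgeConjecture.HodgeConjecture`)
set_option linter.dupNamespace false

noncomputable section

open scoped Matrix ComplexConjugate
open Complex Matrix NumberField NumberField.InfinitePlace IsDedekindDomain MeasureTheory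
open Literature.NumberTheory.ModularForms.SiegelUpperHalfSpace (denom)
open Literature.NumberTheory.Automorphic Literature.NumberTheory.Automorphic.UnitaryGroup Literature.NumberTheory.GaloisRepresentations
open Literature.NumberTheory.GelbartRogawski1991 Literature.NumberTheory.GelbartRogawski1991.GRConstruction
open Literature.NumberTheory.GelbartRogawski1991.UnitaryDualPair

namespace Summit.HodgeConjecture.HodgeConjecture.Cruxes.HLiu418.K2LiuKindOneSingularArchLocalReadingAtWeylFrame

open K2LiuSiegelUnipotentFourierDefs
open K2LiuHermTwoGammaDefs (hermTwo)
open K2LiuArchInducedTubeDefs (hermOfReal archScalarSection conjTranspose_hermOfReal)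
open K2LiuHermitianTubeCocycle (mul_mem_UJ J_mem transl_mem_iff levi_mem_iff)
open K2LiuKindOneSingularCornerIndexDatum (exists_cornerDatum_at_place)
open K2LiuKindOneSingularArchLocalReadingOfRecord (framedCornerIndex_eq_of_pos framedCornerIndex_eq_of_neg)

/-! ## §1 The Weyl element in the Shimura frame: the Siegel-Levi sign unit -/

section Weyl

/-- **`T·diag(1,−1)·T⁻¹ = (0 −diag(i·sgn t); diag(i·sgn t) 0)`** for the explicit Shimura frames of the datum `t` (★ `exists_tubeFrame_arch₄` (x) letters; ★
`frame_mul_blockDiag_mul_frameInv` in letters, then `D·P₁ = C·P₀ = ½·diag(i·sgn t)`). [cite: Shimura1997, §6.4] -/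
theorem shimuraFrame_weyl_eq (T Tinv : Matrix (Fin 2 ⊕ Fin 2) (Fin 2 ⊕ Fin 2) ℂ) (t : Fin 2 → ℝ) (ht : ∀ i, t i ≠ 0)
    (hTdef : T = fromBlocks (diagonal (fun i => (Real.sqrt (|t i| / 2) : ℂ))) (diagonal (fun i => (Real.sqrt (|t i| / 2) : ℂ)))
          (diagonal (fun i => I * (((t i / |t i|) * Real.sqrt (|t i| / 2) : ℝ) : ℂ))) (-diagonal (fun i => I * (((t i / |t i|) * Real.sqrt (|t i| / 2) : ℝ) : ℂ))))
    (hTinvdef : Tinv = fromBlocks (diagonal (fun i => (((Real.sqrt (|t i| / 2))⁻¹ / 2 : ℝ) : ℂ))) (-diagonal (fun i => I * (((Real.sqrt (|t i| / 2))⁻¹ * (t i / |t i|) / 2 : ℝ) : ℂ)))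
          (diagonal (fun i => (((Real.sqrt (|t i| / 2))⁻¹ / 2 : ℝ) : ℂ))) (diagonal (fun i => I * (((Real.sqrt (|t i| / 2))⁻¹ * (t i / |t i|) / 2 : ℝ) : ℂ)))) :
    T * fromBlocks 1 0 0 (-1) * Tinv =
      fromBlocks 0 (-diagonal (fun i => I * ((t i / |t i| : ℝ) : ℂ))) (diagonal (fun i => I * ((t i / |t i| : ℝ) : ℂ))) 0 := by
  subst hTdef hTinvdef
  rw [K2LiuHermitianTubeFrameWeyl.frame_mul_blockDiag_mul_frameInv, diagonal_mul_diagonal, diagonal_mul_diagonal, diagonal_add, diagonal_add]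
  have hr : ∀ i, ((Real.sqrt (|t i| / 2) : ℝ) : ℂ) ≠ 0 := fun i => by
    exact_mod_cast (Real.sqrt_pos.2 (div_pos (abs_pos.2 (ht i)) two_pos)).ne'
  have hc : ∀ i, ((Real.sqrt (|t i| / 2) : ℝ) : ℂ) * ((Real.sqrt (|t i| / 2) : ℝ) : ℂ)⁻¹ = 1 := fun i => mul_inv_cancel₀ (hr i)
  congr 1
  · congr 1
    refine congrArg diagonal (funext fun i => ?_)
    push_cast
    linear_combination (I * ((t i : ℂ) / ((|t i| : ℝ) : ℂ))) * hc i
  · refine congrArg diagonal (funext fun i => ?_)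
    push_cast
    linear_combination (I * ((t i : ℂ) / ((|t i| : ℝ) : ℂ))) * hc i

/-- `u·J = (0 −diag d; diag d 0)` for the Siegel-Levi element `u = diag d ⊕ diag d` (`J = (0 −1; 1 0)`). [folklore] -/
theorem leviSign_mul_J (d : Fin 2 → ℂ) :
    fromBlocks (diagonal d) 0 0 (diagonal d) * Matrix.J (Fin 2) ℂ = fromBlocks 0 (-diagonal d) (diagonal d) 0 := by
  rw [Matrix.J, fromBlocks_multiply]
  simp

/-- **the Siegel-Levi sign unit is in `U(J)`**: `u_w = diag(i·sgn t) ⊕ diag(i·sgn t)` has `u₁₁ᴴ·u₂₂ = diag(|i·sgn t|²) = 1`. [cite: Shimura1997, §5.1] -/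
theorem leviSign_mem_UJ (t : Fin 2 → ℝ) (ht : ∀ i, t i ≠ 0) :
    (fromBlocks (diagonal (fun i => I * ((t i / |t i| : ℝ) : ℂ))) 0 0 (diagonal (fun i => I * ((t i / |t i| : ℝ) : ℂ))))ᴴ * Matrix.J (Fin 2) ℂ *
        fromBlocks (diagonal (fun i => I * ((t i / |t i| : ℝ) : ℂ))) 0 0 (diagonal (fun i => I * ((t i / |t i| : ℝ) : ℂ))) = Matrix.J (Fin 2) ℂ := by
  rw [levi_mem_iff, diagonal_conjTranspose, diagonal_mul_diagonal, ← diagonal_one]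
  refine congrArg diagonal (funext fun i => ?_)
  have hs : (t i / |t i|) * (t i / |t i|) = 1 := by
    rw [div_mul_div_comm, ← abs_mul_abs_self (t i), div_self (mul_ne_zero (abs_ne_zero.2 (ht i)) (abs_ne_zero.2 (ht i)))]
  have hsC : ((t i / |t i| : ℝ) : ℂ) * ((t i / |t i| : ℝ) : ℂ) = 1 := by exact_mod_cast hs
  rw [Pi.star_apply, star_mul', Complex.star_def, Complex.conj_I, Complex.conj_ofReal]
  linear_combination (-(I * I)) * hsC - Complex.I_mul_I

/-- **THE PARABOLIC LAW AT THE SIEGEL-LEVI SIGN UNIT**: `f⁰_{s,k}(u_w·m) = (−sgn t₀·sgn t₁)^k · f⁰_{s,k}(m)` for every `m` (★ `isArchSiegelSection_archScalarSection` at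
`p := u_w ∈ U(J) ∩ P_Δ`: `det (u_w)₁₁ = (i·sgn t₀)(i·sgn t₁) = −sgn t₀·sgn t₁` has modulus `1` and is real). [cite: Shimura1997, §16.4] -/
theorem archScalarSection_leviSign_mul (t : Fin 2 → ℝ) (ht : ∀ i, t i ≠ 0) (k : ℤ) (s : ℂ) (m : Matrix (Fin 2 ⊕ Fin 2) (Fin 2 ⊕ Fin 2) ℂ) :
    archScalarSection k s (fromBlocks (diagonal (fun i => I * ((t i / |t i| : ℝ) : ℂ))) 0 0 (diagonal (fun i => I * ((t i / |t i| : ℝ) : ℂ))) * m) =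
      ((-((t 0 / |t 0|) * (t 1 / |t 1|)) : ℝ) : ℂ) ^ k * archScalarSection k s m := by
  have hlaw := K2LiuArchInducedTubeSection.isArchSiegelSection_archScalarSection (l := Fin 2) k s _ m (leviSign_mem_UJ t ht) (toBlocks_fromBlocks₂₁ _ _ _ _)
  rw [hlaw, toBlocks_fromBlocks₁₁, det_diagonal, Fin.prod_univ_two]
  dsimp only
  -- the determinant `(i·s₀)(i·s₁) = −s₀s₁`, real of modulus one
  have habs : ∀ i, abs (t i / abs (t i)) = 1 := fun i => by rw [abs_div, abs_abs, div_self (abs_ne_zero.2 (ht i))]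
  have hdet : I * ((t 0 / |t 0| : ℝ) : ℂ) * (I * ((t 1 / |t 1| : ℝ) : ℂ)) = ((-((t 0 / |t 0|) * (t 1 / |t 1|)) : ℝ) : ℂ) := by
    rw [Complex.ofReal_neg, Complex.ofReal_mul]
    linear_combination (((t 0 / |t 0| : ℝ) : ℂ) * ((t 1 / |t 1| : ℝ) : ℂ)) * Complex.I_mul_I
  have hnorm : ‖((-((t 0 / |t 0|) * (t 1 / |t 1|)) : ℝ) : ℂ)‖ = 1 := by
    rw [Complex.norm_real, Real.norm_eq_abs, abs_neg, abs_mul, habs, habs, mul_one]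
  rw [hdet, hnorm, Complex.ofReal_one, div_one, Complex.one_cpow, mul_one, Complex.conj_ofReal]

end Weyl

/-! ## §2 The pointwise reading of record with the merged letter `hFsx`, and ★ p864726's `hA₀` -/

section Bridge

variable (L : Type) [Field L] [NumberField L] [IsCMField L]
variable {N M : ℕ} (e : Fin N × Fin M ≃ Fin 2) (dV : Fin N → L) (hdV : ∀ i, IsCMField.complexConj L (dV i) = dV i)
  (dW : Fin M → L) (hdW : ∀ i, IsCMField.complexConj L (dW i) = dW i)

/-- **(ρ) ED.2 THE POINTWISE ARCH READING OF RECORD, BOTH SIGNS, WITH THE MERGED LETTER `hFsx`.**  ★ p865158 `theta_eq_of_record` with `(hFs, hFrx)` replaced by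
`hFsx : ∀ X p w s m, mᴴJm = J → Fs X p w s (Frx X w · m) = cF p w · archScalarSection (k p w) s (J·m)` (the flat section read at the Weyl frame is scalar type; paid by §3 from the
record's `Frx = T·diag(1,−1)·T⁻¹` and the pure scalar-type reading); all other letters and the conclusion VERBATIM.
[cite: Shimura1997, §18.1 (18.4), §18.4] [cite: KudlaRallis1994, §2 (2.10)–(2.12)] -/
theorem theta_eq_of_record₂ {φ : Type*} [DecidableEq {w : InfinitePlace L // w.IsComplex}] (Tinf : Finset (InfinitePlace L))
    (t : {w : InfinitePlace L // w.IsComplex} → Fin 2 → ℝ) (ht : ∀ w i, t w i ≠ 0) (T Tinv : {w : InfinitePlace L // w.IsComplex} → Matrix (Fin 2 ⊕ Fin 2) (Fin 2 ⊕ Fin 2) ℂ)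
    (hTdef : ∀ w, T w = fromBlocks (diagonal (fun i => (Real.sqrt (|t w i| / 2) : ℂ))) (diagonal (fun i => (Real.sqrt (|t w i| / 2) : ℂ)))
          (diagonal (fun i => Complex.I * (((t w i / |t w i|) * Real.sqrt (|t w i| / 2) : ℝ) : ℂ)))
          (-diagonal (fun i => Complex.I * (((t w i / |t w i|) * Real.sqrt (|t w i| / 2) : ℝ) : ℂ))))
    (hTinvdef : ∀ w, Tinv w = fromBlocks (diagonal (fun i => (((Real.sqrt (|t w i| / 2))⁻¹ / 2 : ℝ) : ℂ)))
          (-diagonal (fun i => Complex.I * (((Real.sqrt (|t w i| / 2))⁻¹ * (t w i / |t w i|) / 2 : ℝ) : ℂ)))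
          (diagonal (fun i => (((Real.sqrt (|t w i| / 2))⁻¹ / 2 : ℝ) : ℂ))) (diagonal (fun i => Complex.I * (((Real.sqrt (|t w i| / 2))⁻¹ * (t w i / |t w i|) / 2 : ℝ) : ℂ))))
    (σc : skewMatrices ((IsCMField.complexConj L : L ≃ₐ[Fp L] L) : L →+* L) ((gramR L e dV hdV dW hdW).map (algebraMap (Fp L) L)) → L)
    (hσskew : ∀ X : skewMatrices ((IsCMField.complexConj L : L ≃ₐ[Fp L] L) : L →+* L) ((gramR L e dV hdV dW hdW).map (algebraMap (Fp L) L)),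
      (X : Matrix (Fin 2) (Fin 2) L) ≠ 0 → (X : Matrix (Fin 2) (Fin 2) L).det = 0 → IsCMField.complexConj L (σc X) = -σc X)
    (hσ0 : ∀ X : skewMatrices ((IsCMField.complexConj L : L ≃ₐ[Fp L] L) : L →+* L) ((gramR L e dV hdV dW hdW).map (algebraMap (Fp L) L)),
      (X : Matrix (Fin 2) (Fin 2) L) ≠ 0 → (X : Matrix (Fin 2) (Fin 2) L).det = 0 → σc X ≠ 0)
    (eb : skewMatrices ((IsCMField.complexConj L : L ≃ₐ[Fp L] L) : L →+* L) ((gramR L e dV hdV dW hdW).map (algebraMap (Fp L) L)) → {w : InfinitePlace L // w.IsComplex} →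
      Matrix (Fin 2) (Fin 2) ℂ → ℂ)
    (heb : ∀ (X : skewMatrices ((IsCMField.complexConj L : L ≃ₐ[Fp L] L) : L →+* L) ((gramR L e dV hdV dW hdW).map (algebraMap (Fp L) L))) (w : {w : InfinitePlace L // w.IsComplex})
      (b : Matrix (Fin 2) (Fin 2) ℂ), eb X w b =
      cexp (-(2 * Real.pi * Complex.I) * (((-2 : ℂ) • ((T w).toBlocks₂₂ * (Matrix.single (1 : Fin 2) (1 : Fin 2) (σc X)).map w.1.embedding * (Tinv w).toBlocks₁₁)) * b).trace))
    (k : φ → {w : InfinitePlace L // w.IsComplex} → ℤ)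
    (Fs : skewMatrices ((IsCMField.complexConj L : L ≃ₐ[Fp L] L) : L →+* L) ((gramR L e dV hdV dW hdW).map (algebraMap (Fp L) L)) → φ → {w : InfinitePlace L // w.IsComplex} → ℂ →
      Matrix (Fin 2 ⊕ Fin 2) (Fin 2 ⊕ Fin 2) ℂ → ℂ)
    (cF : φ → {w : InfinitePlace L // w.IsComplex} → ℂ)
    (Frx : skewMatrices ((IsCMField.complexConj L : L ≃ₐ[Fp L] L) : L →+* L) ((gramR L e dV hdV dW hdW).map (algebraMap (Fp L) L)) → {w : InfinitePlace L // w.IsComplex} →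
      Matrix (Fin 2 ⊕ Fin 2) (Fin 2 ⊕ Fin 2) ℂ)
    -- the MERGED letter: the flat section read at the Weyl frame is scalar type
    (hFsx : ∀ X p w s (m : Matrix (Fin 2 ⊕ Fin 2) (Fin 2 ⊕ Fin 2) ℂ), mᴴ * Matrix.J (Fin 2) ℂ * m = Matrix.J (Fin 2) ℂ →
      Fs X p w s (Frx X w * m) = cF p w * archScalarSection (k p w) s (Matrix.J (Fin 2) ℂ * m))
    (w₀ : {w : InfinitePlace L // w.IsComplex})
    (γ : skewMatrices ((IsCMField.complexConj L : L ≃ₐ[Fp L] L) : L →+* L) ((gramR L e dV hdV dW hdW).map (algebraMap (Fp L) L)) → φ → ℂ → ℂ)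
    (sc : skewMatrices ((IsCMField.complexConj L : L ≃ₐ[Fp L] L) : L →+* L) ((gramR L e dV hdV dW hdW).map (algebraMap (Fp L) L)) → φ → InfinitePlace L → ℂ → ℂ)
    (hsc : ∀ X p (w : InfinitePlace L) s, sc X p w s =
      (if (⟨w, IsTotallyComplex.isComplex w⟩ : {w : InfinitePlace L // w.IsComplex}) = w₀ then γ X p s else 1) * cF p ⟨w, IsTotallyComplex.isComplex w⟩)
    (nfr : {w : InfinitePlace L // w.IsComplex} → (Fin 2 → Fin 2 → ℝ) → Matrix (Fin 2 ⊕ Fin 2) (Fin 2 ⊕ Fin 2) ℂ) (hnfr : ∀ w r, nfr w r = fromBlocks 1 (hermOfReal r) 0 1)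
    (blk : Matrix (Fin 2 ⊕ Fin 2) (Fin 2 ⊕ Fin 2) ℂ → Matrix (Fin 2) (Fin 2) ℂ) (hblk : ∀ m, blk m = m.toBlocks₁₂)
    (tw : skewMatrices ((IsCMField.complexConj L : L ≃ₐ[Fp L] L) : L →+* L) ((gramR L e dV hdV dW hdW).map (algebraMap (Fp L) L)) → InfinitePlace L → ℝ)
    (htw_eq : ∀ X : skewMatrices ((IsCMField.complexConj L : L ≃ₐ[Fp L] L) : L →+* L) ((gramR L e dV hdV dW hdW).map (algebraMap (Fp L) L)),
      (X : Matrix (Fin 2) (Fin 2) L) ≠ 0 → (X : Matrix (Fin 2) (Fin 2) L).det = 0 → ∀ w' ∈ Tinf, tw X w' = w' (σc X))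
    (sgn : skewMatrices ((IsCMField.complexConj L : L ≃ₐ[Fp L] L) : L →+* L) ((gramR L e dV hdV dW hdW).map (algebraMap (Fp L) L)) → InfinitePlace L → Bool)
    (hsgnp : ∀ (X : skewMatrices ((IsCMField.complexConj L : L ≃ₐ[Fp L] L) : L →+* L) ((gramR L e dV hdV dW hdW).map (algebraMap (Fp L) L))) (w : InfinitePlace L),
      sgn X w = true → 0 < -((t ⟨w, IsTotallyComplex.isComplex w⟩ 1 / |t ⟨w, IsTotallyComplex.isComplex w⟩ 1|) * (w.embedding (σc X)).im))
    (hsgnn : ∀ (X : skewMatrices ((IsCMField.complexConj L : L ≃ₐ[Fp L] L) : L →+* L) ((gramR L e dV hdV dW hdW).map (algebraMap (Fp L) L))) (w : InfinitePlace L),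
      sgn X w = false → ¬ 0 < -((t ⟨w, IsTotallyComplex.isComplex w⟩ 1 / |t ⟨w, IsTotallyComplex.isComplex w⟩ 1|) * (w.embedding (σc X)).im))
    (a : Matrix (Fin 2) (Fin 2) ℂ) (hay : ∀ y : ℝ, a * hermTwo (y, 0, 0) * aᴴ = Matrix.single 1 1 (y : ℂ)) :
    (∀ X : skewMatrices ((IsCMField.complexConj L : L ≃ₐ[Fp L] L) : L →+* L) ((gramR L e dV hdV dW hdW).map (algebraMap (Fp L) L)),
      (X : Matrix (Fin 2) (Fin 2) L) ≠ 0 → (X : Matrix (Fin 2) (Fin 2) L).det = 0 → ∀ (p : φ), ∀ w ∈ Tinf, sgn X w = true →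
      ∀ (s : ℂ) (g : Matrix (Fin 2 ⊕ Fin 2) (Fin 2 ⊕ Fin 2) ℂ), gᴴ * Matrix.J (Fin 2) ℂ * g = Matrix.J (Fin 2) ℂ → ∀ r : Fin 2 → Fin 2 → ℝ,
        (if (⟨w, IsTotallyComplex.isComplex w⟩ : {w : InfinitePlace L // w.IsComplex}) = w₀ then γ X p s else 1) *
            eb X ⟨w, IsTotallyComplex.isComplex w⟩ (blk (nfr ⟨w, IsTotallyComplex.isComplex w⟩ r)) *
            Fs X p ⟨w, IsTotallyComplex.isComplex w⟩ s (Frx X ⟨w, IsTotallyComplex.isComplex w⟩ * nfr ⟨w, IsTotallyComplex.isComplex w⟩ r * g) =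
          sc X p w s * (cexp (-(2 * Real.pi * Complex.I) * ((a * hermTwo (tw X w, 0, 0) * aᴴ) * hermOfReal r).trace) *
            archScalarSection (k p ⟨w, IsTotallyComplex.isComplex w⟩) s (Matrix.J (Fin 2) ℂ * fromBlocks 1 (hermOfReal r) 0 1 * g))) ∧
    (∀ X : skewMatrices ((IsCMField.complexConj L : L ≃ₐ[Fp L] L) : L →+* L) ((gramR L e dV hdV dW hdW).map (algebraMap (Fp L) L)),
      (X : Matrix (Fin 2) (Fin 2) L) ≠ 0 → (X : Matrix (Fin 2) (Fin 2) L).det = 0 → ∀ (p : φ), ∀ w ∈ Tinf, sgn X w = false →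
      ∀ (s : ℂ) (g : Matrix (Fin 2 ⊕ Fin 2) (Fin 2 ⊕ Fin 2) ℂ), gᴴ * Matrix.J (Fin 2) ℂ * g = Matrix.J (Fin 2) ℂ → ∀ r : Fin 2 → Fin 2 → ℝ,
        (if (⟨w, IsTotallyComplex.isComplex w⟩ : {w : InfinitePlace L // w.IsComplex}) = w₀ then γ X p s else 1) *
            eb X ⟨w, IsTotallyComplex.isComplex w⟩ (blk (nfr ⟨w, IsTotallyComplex.isComplex w⟩ r)) *
            Fs X p ⟨w, IsTotallyComplex.isComplex w⟩ s (Frx X ⟨w, IsTotallyComplex.isComplex w⟩ * nfr ⟨w, IsTotallyComplex.isComplex w⟩ r * g) =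
          sc X p w s * (cexp (-(2 * Real.pi * Complex.I) * ((-(a * hermTwo (tw X w, 0, 0) * aᴴ)) * hermOfReal r).trace) *
            archScalarSection (k p ⟨w, IsTotallyComplex.isComplex w⟩) s (Matrix.J (Fin 2) ℂ * fromBlocks 1 (hermOfReal r) 0 1 * g))) := by
  -- the translate frame `n(r)·g ∈ U(J)`, so `hFsx` reads `Fs (Frx·(n(r)·g))`
  have hng : ∀ (r : Fin 2 → Fin 2 → ℝ) (g : Matrix (Fin 2 ⊕ Fin 2) (Fin 2 ⊕ Fin 2) ℂ), gᴴ * Matrix.J (Fin 2) ℂ * g = Matrix.J (Fin 2) ℂ →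
      (fromBlocks 1 (hermOfReal r) 0 1 * g)ᴴ * Matrix.J (Fin 2) ℂ * (fromBlocks 1 (hermOfReal r) 0 1 * g) = Matrix.J (Fin 2) ℂ := fun r g hg =>
    mul_mem_UJ ((transl_mem_iff _).2 (conjTranspose_hermOfReal r)) hg
  refine ⟨fun X hX hdet p w hw hsg s g hg r => ?_, fun X hX hdet p w hw hsg s g hg r => ?_⟩
  · have hidxp : (-2 : ℂ) • ((T ⟨w, IsTotallyComplex.isComplex w⟩).toBlocks₂₂ *
        (Matrix.single (1 : Fin 2) (1 : Fin 2) (σc X)).map (⟨w, IsTotallyComplex.isComplex w⟩ : {w : InfinitePlace L // w.IsComplex}).1.embedding *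
        (Tinv ⟨w, IsTotallyComplex.isComplex w⟩).toBlocks₁₁) = a * hermTwo (tw X w, 0, 0) * aᴴ := by
      rw [htw_eq X hX hdet w hw]
      exact framedCornerIndex_eq_of_pos ⟨w, IsTotallyComplex.isComplex w⟩ _ _ _ (ht _) (hTdef _) (hTinvdef _) a hay (hσskew X hX hdet) (hsgnp X w hsg)
    have hFs' := hFsx X p (⟨w, IsTotallyComplex.isComplex w⟩ : {w : InfinitePlace L // w.IsComplex}) s _ (hng r g hg)
    simp only [hsc, hblk, hnfr, Matrix.toBlocks_fromBlocks₁₂, heb, hidxp]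
    rw [Matrix.mul_assoc (Frx X _), hFs']
    simp only [Matrix.mul_assoc]
    ring
  · obtain ⟨_, -, hx⟩ := exists_cornerDatum_at_place ⟨w, IsTotallyComplex.isComplex w⟩ _ _ _ (ht _) (hTdef _) (hTinvdef _) 1
    have hneg : -((t ⟨w, IsTotallyComplex.isComplex w⟩ 1 / |t ⟨w, IsTotallyComplex.isComplex w⟩ 1|) * (w.embedding (σc X)).im) < 0 :=
      ((hx (σc X) (hσskew X hX hdet)).2.2 (hσ0 X hX hdet)).resolve_left (hsgnn X w hsg)
    have hidxn : (-2 : ℂ) • ((T ⟨w, IsTotallyComplex.isComplex w⟩).toBlocks₂₂ *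
        (Matrix.single (1 : Fin 2) (1 : Fin 2) (σc X)).map (⟨w, IsTotallyComplex.isComplex w⟩ : {w : InfinitePlace L // w.IsComplex}).1.embedding *
        (Tinv ⟨w, IsTotallyComplex.isComplex w⟩).toBlocks₁₁) = -(a * hermTwo (tw X w, 0, 0) * aᴴ) := by
      rw [htw_eq X hX hdet w hw]
      exact framedCornerIndex_eq_of_neg ⟨w, IsTotallyComplex.isComplex w⟩ _ _ _ (ht _) (hTdef _) (hTinvdef _) a hay (hσskew X hX hdet) hneg
    have hFs' := hFsx X p (⟨w, IsTotallyComplex.isComplex w⟩ : {w : InfinitePlace L // w.IsComplex}) s _ (hng r g hg)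
    simp only [hsc, hblk, hnfr, Matrix.toBlocks_fromBlocks₁₂, heb, hidxn]
    rw [Matrix.mul_assoc (Frx X _), hFs']
    simp only [Matrix.mul_assoc]
    ring

/-- **★ p864726's `hA₀` FROM (α) ED.3's `hA₀p' hA₀n'`, MERGED LETTER EDITION** (★ p865158 `hA₀_of_hA₀'` with `(hFs, hFrx)` replaced by `hFsx`; conclusion = ★
`K2LiuIncoherentRankOneBlockDArchOfRecord.blockD_arch_of_record`'s hypothesis `hA₀` :121–:128 VERBATIM at `n = 2`, `Rc := Fin 2 → Fin 2 → ℝ`, `B := M₂(ℂ)`, faces `I` generic;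
hypotheses `hA₀p' hA₀n'` = ★ p865128 (C2p)(C2n) :98–:109 VERBATIM). [cite: Shimura1997, §18.4] [cite: KudlaRallis1994, §2 (2.10)–(2.12)] -/
theorem hA₀_of_hA₀'₂ {φ : Type*} [DecidableEq {w : InfinitePlace L // w.IsComplex}]
    (I : skewMatrices ((IsCMField.complexConj L : L ≃ₐ[Fp L] L) : L →+* L) ((gramR L e dV hdV dW hdW).map (algebraMap (Fp L) L)) → HA L e dV hdV dW hdW → Finset φ)
    (Tinf : Finset (InfinitePlace L))
    (t : {w : InfinitePlace L // w.IsComplex} → Fin 2 → ℝ) (ht : ∀ w i, t w i ≠ 0) (T Tinv : {w : InfinitePlace L // w.IsComplex} → Matrix (Fin 2 ⊕ Fin 2) (Fin 2 ⊕ Fin 2) ℂ)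
    (hTdef : ∀ w, T w = fromBlocks (diagonal (fun i => (Real.sqrt (|t w i| / 2) : ℂ))) (diagonal (fun i => (Real.sqrt (|t w i| / 2) : ℂ)))
          (diagonal (fun i => Complex.I * (((t w i / |t w i|) * Real.sqrt (|t w i| / 2) : ℝ) : ℂ)))
          (-diagonal (fun i => Complex.I * (((t w i / |t w i|) * Real.sqrt (|t w i| / 2) : ℝ) : ℂ))))
    (hTinvdef : ∀ w, Tinv w = fromBlocks (diagonal (fun i => (((Real.sqrt (|t w i| / 2))⁻¹ / 2 : ℝ) : ℂ)))
          (-diagonal (fun i => Complex.I * (((Real.sqrt (|t w i| / 2))⁻¹ * (t w i / |t w i|) / 2 : ℝ) : ℂ)))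
          (diagonal (fun i => (((Real.sqrt (|t w i| / 2))⁻¹ / 2 : ℝ) : ℂ))) (diagonal (fun i => Complex.I * (((Real.sqrt (|t w i| / 2))⁻¹ * (t w i / |t w i|) / 2 : ℝ) : ℂ))))
    (σc : skewMatrices ((IsCMField.complexConj L : L ≃ₐ[Fp L] L) : L →+* L) ((gramR L e dV hdV dW hdW).map (algebraMap (Fp L) L)) → L)
    (hσskew : ∀ X : skewMatrices ((IsCMField.complexConj L : L ≃ₐ[Fp L] L) : L →+* L) ((gramR L e dV hdV dW hdW).map (algebraMap (Fp L) L)),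
      (X : Matrix (Fin 2) (Fin 2) L) ≠ 0 → (X : Matrix (Fin 2) (Fin 2) L).det = 0 → IsCMField.complexConj L (σc X) = -σc X)
    (hσ0 : ∀ X : skewMatrices ((IsCMField.complexConj L : L ≃ₐ[Fp L] L) : L →+* L) ((gramR L e dV hdV dW hdW).map (algebraMap (Fp L) L)),
      (X : Matrix (Fin 2) (Fin 2) L) ≠ 0 → (X : Matrix (Fin 2) (Fin 2) L).det = 0 → σc X ≠ 0)
    (eb : skewMatrices ((IsCMField.complexConj L : L ≃ₐ[Fp L] L) : L →+* L) ((gramR L e dV hdV dW hdW).map (algebraMap (Fp L) L)) → {w : InfinitePlace L // w.IsComplex} →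
      Matrix (Fin 2) (Fin 2) ℂ → ℂ)
    (heb : ∀ (X : skewMatrices ((IsCMField.complexConj L : L ≃ₐ[Fp L] L) : L →+* L) ((gramR L e dV hdV dW hdW).map (algebraMap (Fp L) L))) (w : {w : InfinitePlace L // w.IsComplex})
      (b : Matrix (Fin 2) (Fin 2) ℂ), eb X w b =
      cexp (-(2 * Real.pi * Complex.I) * (((-2 : ℂ) • ((T w).toBlocks₂₂ * (Matrix.single (1 : Fin 2) (1 : Fin 2) (σc X)).map w.1.embedding * (Tinv w).toBlocks₁₁)) * b).trace))
    (k : φ → {w : InfinitePlace L // w.IsComplex} → ℤ)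
    (Fs : skewMatrices ((IsCMField.complexConj L : L ≃ₐ[Fp L] L) : L →+* L) ((gramR L e dV hdV dW hdW).map (algebraMap (Fp L) L)) → φ → {w : InfinitePlace L // w.IsComplex} → ℂ →
      Matrix (Fin 2 ⊕ Fin 2) (Fin 2 ⊕ Fin 2) ℂ → ℂ)
    (cF : φ → {w : InfinitePlace L // w.IsComplex} → ℂ)
    (Frx : skewMatrices ((IsCMField.complexConj L : L ≃ₐ[Fp L] L) : L →+* L) ((gramR L e dV hdV dW hdW).map (algebraMap (Fp L) L)) → {w : InfinitePlace L // w.IsComplex} →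
      Matrix (Fin 2 ⊕ Fin 2) (Fin 2 ⊕ Fin 2) ℂ)
    (hFsx : ∀ X p w s (m : Matrix (Fin 2 ⊕ Fin 2) (Fin 2 ⊕ Fin 2) ℂ), mᴴ * Matrix.J (Fin 2) ℂ * m = Matrix.J (Fin 2) ℂ →
      Fs X p w s (Frx X w * m) = cF p w * archScalarSection (k p w) s (Matrix.J (Fin 2) ℂ * m))
    (w₀ : {w : InfinitePlace L // w.IsComplex})
    (γ : skewMatrices ((IsCMField.complexConj L : L ≃ₐ[Fp L] L) : L →+* L) ((gramR L e dV hdV dW hdW).map (algebraMap (Fp L) L)) → φ → ℂ → ℂ)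
    (sc : skewMatrices ((IsCMField.complexConj L : L ≃ₐ[Fp L] L) : L →+* L) ((gramR L e dV hdV dW hdW).map (algebraMap (Fp L) L)) → φ → InfinitePlace L → ℂ → ℂ)
    (hsc : ∀ X p (w : InfinitePlace L) s, sc X p w s =
      (if (⟨w, IsTotallyComplex.isComplex w⟩ : {w : InfinitePlace L // w.IsComplex}) = w₀ then γ X p s else 1) * cF p ⟨w, IsTotallyComplex.isComplex w⟩)
    (nfr : {w : InfinitePlace L // w.IsComplex} → (Fin 2 → Fin 2 → ℝ) → Matrix (Fin 2 ⊕ Fin 2) (Fin 2 ⊕ Fin 2) ℂ) (hnfr : ∀ w r, nfr w r = fromBlocks 1 (hermOfReal r) 0 1)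
    (blk : Matrix (Fin 2 ⊕ Fin 2) (Fin 2 ⊕ Fin 2) ℂ → Matrix (Fin 2) (Fin 2) ℂ) (hblk : ∀ m, blk m = m.toBlocks₁₂)
    (tw : skewMatrices ((IsCMField.complexConj L : L ≃ₐ[Fp L] L) : L →+* L) ((gramR L e dV hdV dW hdW).map (algebraMap (Fp L) L)) → InfinitePlace L → ℝ)
    (htw_eq : ∀ X : skewMatrices ((IsCMField.complexConj L : L ≃ₐ[Fp L] L) : L →+* L) ((gramR L e dV hdV dW hdW).map (algebraMap (Fp L) L)),
      (X : Matrix (Fin 2) (Fin 2) L) ≠ 0 → (X : Matrix (Fin 2) (Fin 2) L).det = 0 → ∀ w' ∈ Tinf, tw X w' = w' (σc X))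
    (sgn : skewMatrices ((IsCMField.complexConj L : L ≃ₐ[Fp L] L) : L →+* L) ((gramR L e dV hdV dW hdW).map (algebraMap (Fp L) L)) → InfinitePlace L → Bool)
    (hsgnp : ∀ (X : skewMatrices ((IsCMField.complexConj L : L ≃ₐ[Fp L] L) : L →+* L) ((gramR L e dV hdV dW hdW).map (algebraMap (Fp L) L))) (w : InfinitePlace L),
      sgn X w = true → 0 < -((t ⟨w, IsTotallyComplex.isComplex w⟩ 1 / |t ⟨w, IsTotallyComplex.isComplex w⟩ 1|) * (w.embedding (σc X)).im))
    (hsgnn : ∀ (X : skewMatrices ((IsCMField.complexConj L : L ≃ₐ[Fp L] L) : L →+* L) ((gramR L e dV hdV dW hdW).map (algebraMap (Fp L) L))) (w : InfinitePlace L),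
      sgn X w = false → ¬ 0 < -((t ⟨w, IsTotallyComplex.isComplex w⟩ 1 / |t ⟨w, IsTotallyComplex.isComplex w⟩ 1|) * (w.embedding (σc X)).im))
    (a : Matrix (Fin 2) (Fin 2) ℂ) (hay : ∀ y : ℝ, a * hermTwo (y, 0, 0) * aᴴ = Matrix.single 1 1 (y : ℂ))
    (Ac₀ : skewMatrices ((IsCMField.complexConj L : L ≃ₐ[Fp L] L) : L →+* L) ((gramR L e dV hdV dW hdW).map (algebraMap (Fp L) L)) → φ → InfinitePlace L → ℂ →
      Matrix (Fin 2 ⊕ Fin 2) (Fin 2 ⊕ Fin 2) ℂ → ℂ)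
    (hA₀p' : ∀ X : skewMatrices ((IsCMField.complexConj L : L ≃ₐ[Fp L] L) : L →+* L) ((gramR L e dV hdV dW hdW).map (algebraMap (Fp L) L)),
      (X : Matrix (Fin 2) (Fin 2) L) ≠ 0 → (X : Matrix (Fin 2) (Fin 2) L).det = 0 → ∀ (h : HA L e dV hdV dW hdW), ∀ p ∈ I X h, ∀ w ∈ Tinf, sgn X w = true →
      ∀ s : ℂ, 1 / 2 < s.re → ∀ g : Matrix (Fin 2 ⊕ Fin 2) (Fin 2 ⊕ Fin 2) ℂ, gᴴ * Matrix.J (Fin 2) ℂ * g = Matrix.J (Fin 2) ℂ →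
          sc X p w s * (∫ r : Fin 2 → Fin 2 → ℝ, cexp (-(2 * Real.pi * Complex.I) * ((a * hermTwo (tw X w, 0, 0) * aᴴ) * hermOfReal r).trace) *
            archScalarSection (k p ⟨w, IsTotallyComplex.isComplex w⟩) s (Matrix.J (Fin 2) ℂ * fromBlocks 1 (hermOfReal r) 0 1 * g)) = Ac₀ X p w s g)
    (hA₀n' : ∀ X : skewMatrices ((IsCMField.complexConj L : L ≃ₐ[Fp L] L) : L →+* L) ((gramR L e dV hdV dW hdW).map (algebraMap (Fp L) L)),
      (X : Matrix (Fin 2) (Fin 2) L) ≠ 0 → (X : Matrix (Fin 2) (Fin 2) L).det = 0 → ∀ (h : HA L e dV hdV dW hdW), ∀ p ∈ I X h, ∀ w ∈ Tinf, sgn X w = false →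
      ∀ s : ℂ, 1 / 2 < s.re → ∀ g : Matrix (Fin 2 ⊕ Fin 2) (Fin 2 ⊕ Fin 2) ℂ, gᴴ * Matrix.J (Fin 2) ℂ * g = Matrix.J (Fin 2) ℂ →
          sc X p w s * (∫ r : Fin 2 → Fin 2 → ℝ, cexp (-(2 * Real.pi * Complex.I) * ((-(a * hermTwo (tw X w, 0, 0) * aᴴ)) * hermOfReal r).trace) *
            archScalarSection (k p ⟨w, IsTotallyComplex.isComplex w⟩) s (Matrix.J (Fin 2) ℂ * fromBlocks 1 (hermOfReal r) 0 1 * g)) = Ac₀ X p w s g) :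
    ∀ X : skewMatrices ((IsCMField.complexConj L : L ≃ₐ[Fp L] L) : L →+* L) ((gramR L e dV hdV dW hdW).map (algebraMap (Fp L) L)),
      (X : Matrix (Fin 2) (Fin 2) L) ≠ 0 → (X : Matrix (Fin 2) (Fin 2) L).det = 0 → ∀ (h : HA L e dV hdV dW hdW), ∀ p ∈ I X h, ∀ w ∈ Tinf,
        ∀ s : ℂ, 1 / 2 < s.re → ∀ g : Matrix (Fin 2 ⊕ Fin 2) (Fin 2 ⊕ Fin 2) ℂ, gᴴ * Matrix.J (Fin 2) ℂ * g = Matrix.J (Fin 2) ℂ →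
          (fun X (p : φ) (w : InfinitePlace L) s (g : Matrix (Fin 2 ⊕ Fin 2) (Fin 2 ⊕ Fin 2) ℂ) =>
              ∫ ρ' : Fin 2 → Fin 2 → ℝ, (if (⟨w, IsTotallyComplex.isComplex w⟩ : {w : InfinitePlace L // w.IsComplex}) = w₀ then γ X p s else 1) *
                eb X ⟨w, IsTotallyComplex.isComplex w⟩ (blk (nfr ⟨w, IsTotallyComplex.isComplex w⟩ ρ')) *
                Fs X p ⟨w, IsTotallyComplex.isComplex w⟩ s (Frx X ⟨w, IsTotallyComplex.isComplex w⟩ * nfr ⟨w, IsTotallyComplex.isComplex w⟩ ρ' * g)) X p w s g =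
            Ac₀ X p w s g := by
  obtain ⟨hθp, hθn⟩ := theta_eq_of_record₂ L e dV hdV dW hdW Tinf t ht T Tinv hTdef hTinvdef σc hσskew hσ0 eb heb k Fs cF Frx hFsx w₀ γ sc hsc nfr hnfr blk hblk
    tw htw_eq sgn hsgnp hsgnn a hay
  intro X hX hdet h p hp w hw s hs g hg
  cases hb : sgn X w
  · rw [← hA₀n' X hX hdet h p hp w hw hb s hs g hg, ← integral_const_mul]
    exact integral_congr_ae (Filter.Eventually.of_forall fun r => hθn X hX hdet p w hw hb s g hg r)
  · rw [← hA₀p' X hX hdet h p hp w hw hb s hs g hg, ← integral_const_mul]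
    exact integral_congr_ae (Filter.Eventually.of_forall fun r => hθp X hX hdet p w hw hb s g hg r)

end Bridge

/-! ## §3 The payer split: the merged letter from the Weyl frame of record and the pure scalar-type reading -/

section Payer

variable {L : Type} [Field L] [NumberField L] [IsCMField L]

/-- **`hFsx` FROM THE RECORD'S WEYL FRAME AND THE PURE SCALAR-TYPE READING.**  For any place-indexed data: if `Frx X w = T_w·diag(1,−1)·T_w⁻¹` (★ `frame_archPart_weylDelta` at the
frames of record, `Frx := fun _ w => Fr (w_Δ)_∞ w`) with the explicit Shimura `T_w, T_w⁻¹`, and the flat section is scalar type on `U(J)` — `Fs X p w s m = cF p w·f⁰_{s,k p w}(m)` (the (T-σ)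
letter) — then `Fs X p w s (Frx X w·m) = cF' p w · f⁰_{s,k p w}(J·m)` on `U(J)` with `cF' p w = cF p w·(−sgn t_{w,0}·sgn t_{w,1})^{k p w}` (§1: `Frx = u_w·J`, parabolic law at `u_w`).
[cite: Shimura1997, §6.4, §16.4] -/
theorem hFsx_of_scalarType {Sk φ σ : Type*} (t : σ → Fin 2 → ℝ) (ht : ∀ w i, t w i ≠ 0) (T Tinv : σ → Matrix (Fin 2 ⊕ Fin 2) (Fin 2 ⊕ Fin 2) ℂ)
    (hTdef : ∀ w, T w = fromBlocks (diagonal (fun i => (Real.sqrt (|t w i| / 2) : ℂ))) (diagonal (fun i => (Real.sqrt (|t w i| / 2) : ℂ)))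
          (diagonal (fun i => Complex.I * (((t w i / |t w i|) * Real.sqrt (|t w i| / 2) : ℝ) : ℂ)))
          (-diagonal (fun i => Complex.I * (((t w i / |t w i|) * Real.sqrt (|t w i| / 2) : ℝ) : ℂ))))
    (hTinvdef : ∀ w, Tinv w = fromBlocks (diagonal (fun i => (((Real.sqrt (|t w i| / 2))⁻¹ / 2 : ℝ) : ℂ)))
          (-diagonal (fun i => Complex.I * (((Real.sqrt (|t w i| / 2))⁻¹ * (t w i / |t w i|) / 2 : ℝ) : ℂ)))
          (diagonal (fun i => (((Real.sqrt (|t w i| / 2))⁻¹ / 2 : ℝ) : ℂ))) (diagonal (fun i => Complex.I * (((Real.sqrt (|t w i| / 2))⁻¹ * (t w i / |t w i|) / 2 : ℝ) : ℂ))))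
    (Frx : Sk → σ → Matrix (Fin 2 ⊕ Fin 2) (Fin 2 ⊕ Fin 2) ℂ) (hFrx : ∀ X w, Frx X w = T w * fromBlocks 1 0 0 (-1) * Tinv w)
    (k : φ → σ → ℤ) (Fs : Sk → φ → σ → ℂ → Matrix (Fin 2 ⊕ Fin 2) (Fin 2 ⊕ Fin 2) ℂ → ℂ) (cF : φ → σ → ℂ)
    (hFs : ∀ X p w s (m : Matrix (Fin 2 ⊕ Fin 2) (Fin 2 ⊕ Fin 2) ℂ), mᴴ * Matrix.J (Fin 2) ℂ * m = Matrix.J (Fin 2) ℂ →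
      Fs X p w s m = cF p w * archScalarSection (k p w) s m) :
    ∀ X p w s (m : Matrix (Fin 2 ⊕ Fin 2) (Fin 2 ⊕ Fin 2) ℂ), mᴴ * Matrix.J (Fin 2) ℂ * m = Matrix.J (Fin 2) ℂ →
      Fs X p w s (Frx X w * m) =
        (cF p w * ((-((t w 0 / |t w 0|) * (t w 1 / |t w 1|)) : ℝ) : ℂ) ^ k p w) * archScalarSection (k p w) s (Matrix.J (Fin 2) ℂ * m) := by
  intro X p w s m hm
  have hx : Frx X w = fromBlocks (diagonal (fun i => I * ((t w i / |t w i| : ℝ) : ℂ))) 0 0 (diagonal (fun i => I * ((t w i / |t w i| : ℝ) : ℂ))) * Matrix.J (Fin 2) ℂ := by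
    rw [hFrx, shimuraFrame_weyl_eq (T w) (Tinv w) (t w) (ht w) (hTdef w) (hTinvdef w), leviSign_mul_J]
  have hxm : (Frx X w * m)ᴴ * Matrix.J (Fin 2) ℂ * (Frx X w * m) = Matrix.J (Fin 2) ℂ := by
    rw [hx]
    exact mul_mem_UJ (mul_mem_UJ (leviSign_mem_UJ (t w) (ht w)) J_mem) hm
  rw [hFs X p w s _ hxm, hx, Matrix.mul_assoc, archScalarSection_leviSign_mul (t w) (ht w)]
  ring

end Payer

end Summit.HodgeConjecture.HodgeConjecture.Cruxes.HLiu418.K2LiuKindOneSingularArchLocalReadingAtWeylFrame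

end
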